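import Summits.CriticalPhenomena.PercolationContinuityZ3.Theorems.PercNearOneGluingNoHeavyLowerTailForestRayleighContractSteps2
import HarnessLib

/-!
# Weighted forest negative correlation — contraction V: the contraction theorem

`lsm_of_pinned_contract`: an instance `(D;K;e,f)` with a pinned edge `uv ∈ K`, loop-free, whose
edges avoiding `v` lie in a Rayleigh system `R₀` and with `ux ∈ R₀` for every edge `vx` of the
instance (`x ≠ u`), satisfies `(R)` — for all activities. Induction on the number of edges at `v`,
with the steps of `…ContractPin` / `…ContractSteps2`. See `…ContractPin` for the discussion.
Theorems only; no definitions, no `sorry`.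
-/

open Finset SimpleGraph
open scoped Classical

namespace Summit.CriticalPhenomena.PercolationContinuityZ3.Theorems.ForestRayleigh

variable {V : Type*} [Fintype V] [DecidableEq V]

/-- The contraction theorem with an explicit bound on the number of edges at `v` (induction form). -/
theorem lsm_of_pinned_contract_aux (R₀ : Finset (Sym2 V))
    (hR₀ : ∀ (w : Sym2 V → ℝ), (∀ x, 0 ≤ w x) → ∀ (D K : Finset (Sym2 V)) (e f : Sym2 V),
      D ∪ insert e (insert f K) ⊆ R₀ → Disjoint D K → e ∉ D → e ∉ K → f ∉ D →
      f ∉ K → e ≠ f →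
      (∑ G ∈ D.powerset.filter (fun G =>
        (fromEdgeSet ((G ∪ (insert e (insert f (K))) : Finset (Sym2 V)) : Set (Sym2 V))).IsAcyclic), ∏ y ∈ G, w y) *
        (∑ G ∈ D.powerset.filter (fun G =>
        (fromEdgeSet ((G ∪ (K) : Finset (Sym2 V)) : Set (Sym2 V))).IsAcyclic), ∏ y ∈ G, w y) ≤
      (∑ G ∈ D.powerset.filter (fun G =>
        (fromEdgeSet ((G ∪ (insert e (K)) : Finset (Sym2 V)) : Set (Sym2 V))).IsAcyclic), ∏ y ∈ G, w y) *
        (∑ G ∈ D.powerset.filter (fun G =>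
        (fromEdgeSet ((G ∪ (insert f (K)) : Finset (Sym2 V)) : Set (Sym2 V))).IsAcyclic), ∏ y ∈ G, w y))
    (u v : V) (huv : u ≠ v) (n : ℕ) :
    ∀ (w : Sym2 V → ℝ), (∀ x, 0 ≤ w x) → ∀ (D K : Finset (Sym2 V)) (e f : Sym2 V),
      Disjoint D K → e ∉ D → e ∉ K → f ∉ D → f ∉ K → e ≠ f → s(v, u) ∈ K →
      (∀ z ∈ D ∪ insert e (insert f K), ¬z.IsDiag) →
      (∀ z ∈ D ∪ insert e (insert f K), v ∉ z → z ∈ R₀) →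
      (∀ y, s(v, y) ∈ D ∪ insert e (insert f K) → y ≠ u → s(u, y) ∈ R₀) →
      ((D ∪ insert e (insert f K)).filter (fun z => v ∈ z)).card ≤ n + 1 →
      (∑ G ∈ D.powerset.filter (fun G =>
        (fromEdgeSet ((G ∪ (insert e (insert f (K))) : Finset (Sym2 V)) : Set (Sym2 V))).IsAcyclic), ∏ y ∈ G, w y) *
        (∑ G ∈ D.powerset.filter (fun G =>
        (fromEdgeSet ((G ∪ (K) : Finset (Sym2 V)) : Set (Sym2 V))).IsAcyclic), ∏ y ∈ G, w y) ≤
      (∑ G ∈ D.powerset.filter (fun G =>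
        (fromEdgeSet ((G ∪ (insert e (K)) : Finset (Sym2 V)) : Set (Sym2 V))).IsAcyclic), ∏ y ∈ G, w y) *
        (∑ G ∈ D.powerset.filter (fun G =>
        (fromEdgeSet ((G ∪ (insert f (K)) : Finset (Sym2 V)) : Set (Sym2 V))).IsAcyclic), ∏ y ∈ G, w y) := by
  induction n with
  | zero =>
    intro w hw D K e f hDK heD heK hfD hfK hef huvK hL hR hrr hcard
    have honly : ∀ z ∈ D ∪ insert e (insert f K), v ∈ z → z = s(v, u) := by
      intro z hz hvz
      by_contra hne
      have h2 : ({s(v, u), z} : Finset (Sym2 V)) ⊆ (D ∪ insert e (insert f K)).filter (fun z => v ∈ z) := by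
        intro y hy
        rcases Finset.mem_insert.1 hy with rfl | hy
        · exact Finset.mem_filter.2 ⟨by simp [huvK], Sym2.mem_mk_left _ _⟩
        · rw [Finset.mem_singleton] at hy; subst hy
          exact Finset.mem_filter.2 ⟨hz, hvz⟩
      have := Finset.card_le_card h2
      rw [Finset.card_pair (fun h => hne h.symm)] at this
      omega
    exact lsm_contract_base R₀ hR₀ u v huv w hw D K e f hDK heD heK hfD hfK hef huvK hL hR honly
  | succ n ih =>
    intro w hw D K e f hDK heD heK hfD hfK hef huvK hL hR hrr hcard
    by_cases hex : ∃ x, x ≠ u ∧ s(v, x) ∈ D ∪ insert e (insert f K)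
    swap
    · have honly : ∀ z ∈ D ∪ insert e (insert f K), v ∈ z → z = s(v, u) := by
        intro z hz hvz
        have hz' : s(v, Sym2.Mem.other hvz) = z := Sym2.other_spec hvz
        by_contra hne
        refine hex ⟨Sym2.Mem.other hvz, fun h => hne ?_, by rw [hz']; exact hz⟩
        rw [← hz', h]
      exact lsm_contract_base R₀ hR₀ u v huv w hw D K e f hDK heD heK hfD hfK hef huvK hL hR honly
    obtain ⟨x, hxu, hx⟩ := hex
    have hxv : v ≠ x := fun h => hL _ hx (Sym2.mk_isDiag_iff.2 h)
    have hx' : s(v, x) ∈ D ∨ s(v, x) = e ∨ s(v, x) = f ∨ s(v, x) ∈ K := by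
      simpa only [Finset.mem_union, Finset.mem_insert] using hx
    rcases hx' with hgD | hge | hgf | hgK
    · exact lsm_contract_step_free R₀ u v huv n ih w hw D K e f hDK heD heK hfD hfK hef huvK hL hR hrr
        hcard hxu hxv hgD
    · subst hge
      exact lsm_contract_step_rayleigh R₀ u v huv n ih w hw D K f hDK heD heK hfD hfK hef huvK hL hR
        hrr hcard hxu hxv
    · subst hgf
      have hL' : ∀ z ∈ D ∪ insert s(v, x) (insert e K), ¬z.IsDiag := by
        rw [Finset.insert_comm]; exact hL
      have hR' : ∀ z ∈ D ∪ insert s(v, x) (insert e K), v ∉ z → z ∈ R₀ := by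
        rw [Finset.insert_comm]; exact hR
      have hrr' : ∀ y, s(v, y) ∈ D ∪ insert s(v, x) (insert e K) → y ≠ u → s(u, y) ∈ R₀ := by
        rw [Finset.insert_comm]; exact hrr
      have hcard' : ((D ∪ insert s(v, x) (insert e K)).filter (fun z => v ∈ z)).card ≤ n + 1 + 1 := by
        rw [Finset.insert_comm]; exact hcard
      exact lsm_symm w D K e s(v, x) (lsm_contract_step_rayleigh R₀ u v huv n ih w hw D K e hDK hfD hfK
        heD heK hef.symm huvK hL' hR' hrr' hcard' hxu hxv)
    · exact lsm_contract_step_pin R₀ u v huv n ih w hw D K e f hDK heD heK hfD hfK hef huvK hL hR hrr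
        hcard hxu hxv hgK

/-- **The contraction theorem.** For a Rayleigh system `R₀`, `u ≠ v`, and a loop-free instance
`(D;K;e,f)` with `uv ∈ K`, edges avoiding `v` in `R₀`, and `ux ∈ R₀` for every edge `vx` of the
instance (`x ≠ u`): `(R)(D;K;e,f)` for all activities `w ≥ 0`. [pinned instances = instances of the
contraction; S–W 2008 Prop. 3.7 parallel reductions + re-routing] -/
theorem lsm_of_pinned_contract (R₀ : Finset (Sym2 V))
    (hR₀ : ∀ (w : Sym2 V → ℝ), (∀ x, 0 ≤ w x) → ∀ (D K : Finset (Sym2 V)) (e f : Sym2 V),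
      D ∪ insert e (insert f K) ⊆ R₀ → Disjoint D K → e ∉ D → e ∉ K → f ∉ D →
      f ∉ K → e ≠ f →
      (∑ G ∈ D.powerset.filter (fun G =>
        (fromEdgeSet ((G ∪ (insert e (insert f (K))) : Finset (Sym2 V)) : Set (Sym2 V))).IsAcyclic), ∏ y ∈ G, w y) *
        (∑ G ∈ D.powerset.filter (fun G =>
        (fromEdgeSet ((G ∪ (K) : Finset (Sym2 V)) : Set (Sym2 V))).IsAcyclic), ∏ y ∈ G, w y) ≤
      (∑ G ∈ D.powerset.filter (fun G =>
        (fromEdgeSet ((G ∪ (insert e (K)) : Finset (Sym2 V)) : Set (Sym2 V))).IsAcyclic), ∏ y ∈ G, w y) *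
        (∑ G ∈ D.powerset.filter (fun G =>
        (fromEdgeSet ((G ∪ (insert f (K)) : Finset (Sym2 V)) : Set (Sym2 V))).IsAcyclic), ∏ y ∈ G, w y))
    (u v : V) (huv : u ≠ v) (w : Sym2 V → ℝ) (hw : ∀ x, 0 ≤ w x) (D K : Finset (Sym2 V))
    (e f : Sym2 V) (hDK : Disjoint D K) (heD : e ∉ D) (heK : e ∉ K) (hfD : f ∉ D) (hfK : f ∉ K)
    (hef : e ≠ f) (huvK : s(v, u) ∈ K) (hL : ∀ z ∈ D ∪ insert e (insert f K), ¬z.IsDiag)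
    (hR : ∀ z ∈ D ∪ insert e (insert f K), v ∉ z → z ∈ R₀)
    (hrr : ∀ y, s(v, y) ∈ D ∪ insert e (insert f K) → y ≠ u → s(u, y) ∈ R₀) :
    (∑ G ∈ D.powerset.filter (fun G =>
        (fromEdgeSet ((G ∪ (insert e (insert f (K))) : Finset (Sym2 V)) : Set (Sym2 V))).IsAcyclic), ∏ y ∈ G, w y) *
      (∑ G ∈ D.powerset.filter (fun G =>
        (fromEdgeSet ((G ∪ (K) : Finset (Sym2 V)) : Set (Sym2 V))).IsAcyclic), ∏ y ∈ G, w y) ≤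
    (∑ G ∈ D.powerset.filter (fun G =>
        (fromEdgeSet ((G ∪ (insert e (K)) : Finset (Sym2 V)) : Set (Sym2 V))).IsAcyclic), ∏ y ∈ G, w y) *
      (∑ G ∈ D.powerset.filter (fun G =>
        (fromEdgeSet ((G ∪ (insert f (K)) : Finset (Sym2 V)) : Set (Sym2 V))).IsAcyclic), ∏ y ∈ G, w y) :=
  lsm_of_pinned_contract_aux R₀ hR₀ u v huv _ w hw D K e f hDK heD heK hfD hfK hef huvK hL hR hrr
    (Nat.le_succ_of_le le_rfl)

end Summit.CriticalPhenomena.PercolationContinuityZ3.Theorems.ForestRayleigh
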